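import Mathlib
import HarnessLib
import Summits.Ventures.LatticeQCDFlow.Scoring.KArmPooledEstimate
import Summits.Ventures.LatticeQCDFlow.Scoring.KArmHomogeneityGaussian

/-!
# POOLING AFTER THE HOMOGENEITY TEST IS SAFE ASYMPTOTICALLY: THE POOLED INTERVAL AND THE TEST
# DECISION ARE ASYMPTOTICALLY INDEPENDENT, SO THE POOLED INTERVAL STAYS CALIBRATED CONDITIONALLY
# ON THE TEST PASSING

HONEST FRAMING: exact (Metropolis-corrected) sampling algorithms for lattice gauge theory;
figures of merit are autocorrelation/cost numbers at stated couplings and volumes; no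
continuum-physics claim.

Venture `LatticeQCDFlow` (cell pub-lqcd), topic `Scoring`; FANOUT row 4 (`s0-u1-b`, GEN-35).
NEW WORK of the cell (classical large-sample statistics; our formalisation), no definition,
nothing cited as a fact (Fisher–Cochran independence / "test then pool" practice NAMED ONLY).

WHY (row 4).  The practical protocol is two-stage: run the one-shot homogeneity test of
`Scoring/KArmHomogeneityCoverage` on the `R ≥ 2` implementations, and IF it passes quote the
inverse-variance pooled estimate `m̂ₖ` with its error bar `√V̂ₖ^pool`, `V̂ₖ^pool = (Σ_r 1/V̂ₖ^r)⁻¹`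
(calibrated unconditionally by `Scoring/KArmPooledEstimate`).  Selecting on the test passing could
in principle distort the quoted interval.  This file proves it does not, asymptotically, when the
codes share their target: (i) for independent `Z_r ∼ N(0, s_r)` the joint law of the two limit
functionals factorises — `P'({(Σ_r Z_r/s_r)/√(Σ_r s_r⁻¹) ∈ A} ∩ {Σ_r (Z_r − m̂(Z))²/s_r ∈ B})
= N(0,1)(A) · N(0,1)^{⊗R}{Σ_{r≠0} z_r² ∈ B}` (**`measure_pooled_inter_homogeneity_limit_eq`**, from
`Scoring/GaussianCochranIndependence`); (ii) by the joint convergence of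
`Scoring/KArmPooledEstimate.kArm_pooled_homogeneity_joint_tendsto` and the portmanteau theorem on
`ℝ × ℝ` (**`tendsto_measureReal_preimage_of_tendstoInDistribution_prod`**), the probability that
BOTH the pooled interval covers AND the test passes tends to the PRODUCT
`N(0,1)([−|z|,|z|]) · N(0,1)^{⊗R}{Σ_{r≠0} z_r² ≤ c}` (**`kArm_pooled_homogeneity_coverage`**);
(iii) dividing by `P(Qₖ ≤ c) → N(0,1)^{⊗R}{Σ_{r≠0} z_r² ≤ c} > 0` (`c > 0`,
**`pi_gaussianReal_sumSqErase_le_pos`**): the CONDITIONAL coverage probability of the pooled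
interval GIVEN that the homogeneity test passed tends to the nominal `N(0,1)([−|z|,|z|])`
(**`kArm_pooled_coverage_conditional`**) — "test, then pool" does not bias the pooled error bar
in the large-sample limit under equal targets.

NOT CLAIMED: anything at finite `k` (where the selection effect is real); unequal targets (under a
common drift the pooled estimate inherits the drift — separate file); dependent codes; numbers.
-/

open MeasureTheory ProbabilityTheory Filter Topology Finset

namespace Summit.Ventures.LatticeQCDFlow.Scoring

open Set WithLp

/-! ## §1 Portmanteau for pairs -/

section Portmanteau

variable {Ω : Type*} [MeasurableSpace Ω] {P : Measure Ω} [IsProbabilityMeasure P]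
variable {Ω' : Type*} [MeasurableSpace Ω'] {P' : Measure Ω'} [IsProbabilityMeasure P']

/-- **Portmanteau on `ℝ × ℝ`**: `Tₙ ⇒ L` (pairs) and `P'(L ∈ ∂E) = 0` ⇒ `P(Tₙ ∈ E) → P'(L ∈ E)`, in
real-valued probabilities. [ours] (Mathlib's `ProbabilityMeasure.tendsto_measure_of_null_frontier_of_tendsto'`) -/
theorem tendsto_measureReal_preimage_of_tendstoInDistribution_prod {T : ℕ → Ω → ℝ × ℝ}
    {L : Ω' → ℝ × ℝ} (h : TendstoInDistribution T atTop L (fun _ => P) P') {E : Set (ℝ × ℝ)}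
    (hE : MeasurableSet E) (hfr : (P'.map L) (frontier E) = 0) :
    Tendsto (fun n => P.real (T n ⁻¹' E)) atTop (𝓝 (P'.real (L ⁻¹' E))) := by
  have key := ProbabilityMeasure.tendsto_measure_of_null_frontier_of_tendsto' h.tendsto (E := E)
    (by simpa only [ProbabilityMeasure.coe_mk] using hfr)
  simp only [ProbabilityMeasure.coe_mk] at key
  rw [Measure.map_apply_of_aemeasurable h.aemeasurable_limit hE] at key
  have key' : Tendsto (fun n => P (T n ⁻¹' E)) atTop (𝓝 (P' (L ⁻¹' E))) := by
    refine key.congr fun n => ?_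
    rw [Measure.map_apply_of_aemeasurable (h.forall_aemeasurable n) hE]
  simp only [measureReal_def]
  exact (ENNReal.tendsto_toReal (measure_ne_top P' _)).comp key'

/-- The frontier of a product of two closed half-lines is carried by the two level lines. -/
theorem frontier_Iic_prod_Iic_subset (a b : ℝ) :
    frontier (Iic a ×ˢ Iic b) ⊆ {p : ℝ × ℝ | p.1 = a} ∪ {p : ℝ × ℝ | p.2 = b} := by
  rw [frontier_prod_eq, frontier_Iic, frontier_Iic]
  rintro p (⟨-, h2⟩ | ⟨h1, -⟩)
  · exact Or.inr h2
  · exact Or.inl h1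

end Portmanteau

/-! ## §2 The joint law of the two limit functionals under equal targets -/

section JointLaw

variable {n : ℕ} {Ω' : Type*} [MeasurableSpace Ω'] {P' : Measure Ω'} [IsProbabilityMeasure P']

/-- **THE JOINT LAW FACTORISES**: independent `Z_r ∼ N(0, s_r)` (`s_r > 0`, `R = n + 2`), Borel `A, B`:
`P'({(Σ_r Z_r/s_r)/√(Σ_r s_r⁻¹) ∈ A} ∩ {Σ_r (Z_r − m̂(Z))²/s_r ∈ B})
  = N(0,1)(A) · N(0,1)^{⊗R}{z | Σ_{r≠0} z_r² ∈ B}`. [ours] -/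
theorem measure_pooled_inter_homogeneity_limit_eq {Z : Fin (n + 2) → Ω' → ℝ} {s : Fin (n + 2) → ℝ}
    (hs : ∀ r, 0 < s r) (hZm : ∀ r, Measurable (Z r))
    (hZ : ∀ r, HasLaw (Z r) (gaussianReal 0 (s r).toNNReal) P') (hind : iIndepFun Z P')
    {A B : Set ℝ} (hA : MeasurableSet A) (hB : MeasurableSet B) :
    P' ({ω' | (∑ j, Z j ω' / s j) / Real.sqrt (∑ j, (s j)⁻¹) ∈ A}
        ∩ {ω' | ∑ r, (Z r ω' - (∑ j, Z j ω' / s j) / (∑ j, (s j)⁻¹)) ^ 2 / s r ∈ B})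
      = gaussianReal 0 1 A * (Measure.pi fun _ : Fin (n + 2) => gaussianReal 0 1)
        {z : Fin (n + 2) → ℝ | ∑ r ∈ univ.erase 0, z r ^ 2 ∈ B} := by
  have hlaw := hasLaw_standardise_pi hs hZm hZ hind
  set σ : Fin (n + 2) → ℝ := fun r => Real.sqrt (s r) with hσ
  have hσpos : ∀ r, 0 < σ r := fun r => Real.sqrt_pos.2 (hs r)
  have hσsq : ∀ r, σ r ^ 2 = s r := fun r => Real.sq_sqrt (hs r).le
  have hW : 0 < ∑ j, (s j)⁻¹ := Finset.sum_pos (fun j _ => inv_pos.2 (hs j)) Finset.univ_nonempty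
  set C : Set (Fin (n + 2) → ℝ) :=
    {z | ((∑ j, (0 + σ j * z j) / σ j ^ 2) / (∑ j, (σ j ^ 2)⁻¹) - 0) * Real.sqrt (∑ j, (σ j ^ 2)⁻¹) ∈ A}
      ∩ {z | ∑ i, ((0 + σ i * z i) - (∑ j, (0 + σ j * z j) / σ j ^ 2) / (∑ j, (σ j ^ 2)⁻¹)) ^ 2
        / σ i ^ 2 ∈ B} with hC
  have hCm : MeasurableSet C := by
    simp only [hC]
    exact ((by fun_prop : Measurable fun z : Fin (n + 2) → ℝ =>
      ((∑ j, (0 + σ j * z j) / σ j ^ 2) / (∑ j, (σ j ^ 2)⁻¹) - 0) * Real.sqrt (∑ j, (σ j ^ 2)⁻¹)) hA).inter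
      ((by fun_prop : Measurable fun z : Fin (n + 2) → ℝ => ∑ i, ((0 + σ i * z i)
        - (∑ j, (0 + σ j * z j) / σ j ^ 2) / (∑ j, (σ j ^ 2)⁻¹)) ^ 2 / σ i ^ 2) hB)
  have hsq : Real.sqrt (∑ j, (s j)⁻¹) ≠ 0 := (Real.sqrt_pos.2 hW).ne'
  have hpre : ({ω' | (∑ j, Z j ω' / s j) / Real.sqrt (∑ j, (s j)⁻¹) ∈ A}
        ∩ {ω' | ∑ r, (Z r ω' - (∑ j, Z j ω' / s j) / (∑ j, (s j)⁻¹)) ^ 2 / s r ∈ B})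
      = (fun ω' (r : Fin (n + 2)) => Z r ω' / Real.sqrt (s r)) ⁻¹' C := by
    ext ω'
    simp only [hC, Set.mem_inter_iff, Set.mem_setOf_eq, Set.mem_preimage, zero_add, sub_zero, hσsq]
    have hx : ∀ r, σ r * (Z r ω' / Real.sqrt (s r)) = Z r ω' := fun r => by
      have hsr : Real.sqrt (s r) ≠ 0 := (Real.sqrt_pos.2 (hs r)).ne'
      simp only [hσ]
      field_simp
    simp only [hx]
    have e : (∑ j, Z j ω' / s j) / (∑ j, (s j)⁻¹) * Real.sqrt (∑ j, (s j)⁻¹)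
        = (∑ j, Z j ω' / s j) / Real.sqrt (∑ j, (s j)⁻¹) := by
      rw [div_mul_eq_mul_div, div_eq_div_iff hW.ne' hsq, mul_assoc, Real.mul_self_sqrt hW.le]
    rw [e]
  rw [hpre, ← Measure.map_apply_of_aemeasurable hlaw.aemeasurable hCm, hlaw.map_eq, hC]
  exact pi_gaussianReal_pooled_inter_homogeneity_eq_mul 0 σ hσpos 0 hA hB

/-- **The Gaussian product charges `{z | Σ_{r≠r₀} z_r² ≤ c}`** for `c > 0`. [ours] -/
theorem pi_gaussianReal_sumSqErase_le_pos {ι : Type*} [Fintype ι] [DecidableEq ι] (r₀ : ι) {c : ℝ}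
    (hc : 0 < c) :
    0 < (Measure.pi fun _ : ι => gaussianReal 0 1).real {z : ι → ℝ | ∑ r ∈ univ.erase r₀, z r ^ 2 ≤ c} := by
  haveI : ∀ _i : ι, (gaussianReal (0 : ℝ) 1).IsOpenPosMeasure := fun _ =>
    (gaussianReal_absolutelyContinuous' 0 one_ne_zero).isOpenPosMeasure
  have hopen : IsOpen {z : ι → ℝ | ∑ r ∈ univ.erase r₀, z r ^ 2 < c} :=
    isOpen_lt (by fun_prop) continuous_const
  have hne : ({z : ι → ℝ | ∑ r ∈ univ.erase r₀, z r ^ 2 < c}).Nonempty := ⟨0, by simpa using hc⟩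
  have hpos := hopen.measure_pos (Measure.pi fun _ : ι => gaussianReal 0 1) hne
  have hsub : {z : ι → ℝ | ∑ r ∈ univ.erase r₀, z r ^ 2 < c} ⊆ {z : ι → ℝ | ∑ r ∈ univ.erase r₀, z r ^ 2 ≤ c} :=
    fun z hz => by
      simp only [Set.mem_setOf_eq] at hz ⊢
      exact hz.le
  rw [measureReal_def, ENNReal.toReal_pos_iff]
  exact ⟨hpos.trans_le (measure_mono hsub), measure_lt_top _ _⟩

end JointLaw

/-! ## §3 The pooled interval and the test decision: joint and conditional limits -/

section AfterTest

variable {n : ℕ} {Ωs : Fin (n + 2) → Type*} [∀ r, MeasurableSpace (Ωs r)]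
  {Ps : (r : Fin (n + 2)) → Measure (Ωs r)} [∀ r, IsProbabilityMeasure (Ps r)]
variable {Ω' : Type*} [MeasurableSpace Ω'] {P' : Measure Ω'} [IsProbabilityMeasure P']

/-- **THE PROBABILITY THAT THE POOLED INTERVAL COVERS *AND* THE HOMOGENEITY TEST PASSES TENDS TO THE
PRODUCT OF THE TWO NOMINAL PROBABILITIES.**  `R = n + 2 ≥ 2` codes with the same target `a`,
`√k(Sₖ^r − a) ⇒ N(0, s_r)` (`s_r > 0`) independent, `k·V̂ₖ^r → s_r` a.s.: for every `z`, `c`,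
`P((m̂ₖ − a)²·Σ_r (V̂ₖ^r)⁻¹ ≤ z² ∧ Σ_r (Sₖ^r − m̂ₖ)²/V̂ₖ^r ≤ c)
  → N(0,1)([−|z|,|z|]) · N(0,1)^{⊗R}{Σ_{r≠0} z_r² ≤ c}`. [ours] -/
theorem kArm_pooled_homogeneity_coverage {S V : (r : Fin (n + 2)) → ℕ → Ωs r → ℝ} {a : ℝ}
    {s : Fin (n + 2) → ℝ} {Z : Fin (n + 2) → Ω' → ℝ} (hs : ∀ r, 0 < s r)
    (hSm : ∀ r k, Measurable (S r k)) (hVm : ∀ r k, Measurable (V r k))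
    (hclt : ∀ r, TendstoInDistribution (fun (k : ℕ) ω => Real.sqrt k * (S r k ω - a)) atTop (Z r)
      (fun _ => Ps r) P')
    (hZm : ∀ r, Measurable (Z r)) (hZ : ∀ r, HasLaw (Z r) (gaussianReal 0 (s r).toNNReal) P')
    (hind : iIndepFun Z P')
    (hV : ∀ r, ∀ᵐ ω ∂(Ps r), Tendsto (fun k : ℕ => (k : ℝ) * V r k ω) atTop (𝓝 (s r))) (z c : ℝ) :
    Tendsto (fun k : ℕ => (Measure.pi Ps).real ({ω : (r : Fin (n + 2)) → Ωs r |
        ((∑ j, S j k (ω j) / V j k (ω j)) / (∑ j, (V j k (ω j))⁻¹) - a) ^ 2 * (∑ j, (V j k (ω j))⁻¹)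
          ≤ z ^ 2} ∩ {ω | ∑ r, (S r k (ω r) - (∑ j, S j k (ω j) / V j k (ω j)) / (∑ j, (V j k (ω j))⁻¹)) ^ 2
          / V r k (ω r) ≤ c}))
      atTop (𝓝 ((gaussianReal 0 1).real (Icc (-|z|) |z|)
        * (Measure.pi fun _ : Fin (n + 2) => gaussianReal 0 1).real
          {x : Fin (n + 2) → ℝ | ∑ r ∈ univ.erase 0, x r ^ 2 ≤ c})) := by
  have hpair := kArm_pooled_homogeneity_joint_tendsto hs hSm hVm hclt hZm hind hV
  set L : Ω' → ℝ × ℝ := fun ω' => ((∑ j, Z j ω' / s j) ^ 2 / (∑ j, (s j)⁻¹),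
    ∑ r, (Z r ω' - (∑ j, Z j ω' / s j) / (∑ j, (s j)⁻¹)) ^ 2 / s r) with hL
  have hLm : Measurable L := by
    simp only [hL]
    fun_prop
  have hW : 0 < ∑ j, (s j)⁻¹ := Finset.sum_pos (fun j _ => inv_pos.2 (hs j)) Finset.univ_nonempty
  -- the frontier of `Iic z² ×ˢ Iic c` is not charged by the law of `L`
  have h1 : P' {ω' | (∑ j, Z j ω' / s j) ^ 2 / (∑ j, (s j)⁻¹) = z ^ 2} = 0 := by
    have h := measure_pooled_limit_sq_preimage_eq hs hZm hZ hind (measurableSet_singleton (z ^ 2))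
    simp only [Set.mem_singleton_iff] at h
    rw [h]
    have hsub : {t : ℝ | t ^ 2 = z ^ 2} ⊆ {z, -z} := by
      intro t ht
      simp only [Set.mem_setOf_eq] at ht
      rcases sq_eq_sq_iff_eq_or_eq_neg.1 ht with h1 | h1
      · simp [h1]
      · simp [h1]
    exact measure_mono_null hsub (by
      haveI := nullSingletonClass_gaussianReal (μ := 0) one_ne_zero
      exact (Set.toFinite _).measure_zero _)
  have h2 : P' {ω' | ∑ r, (Z r ω' - (∑ j, Z j ω' / s j) / (∑ j, (s j)⁻¹)) ^ 2 / s r = c} = 0 :=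
    measure_homogeneity_limit_levelSet_eq_zero hs hZm hZ hind c
  have hfr : (P'.map L) (frontier (Iic (z ^ 2) ×ˢ Iic c)) = 0 := by
    refine measure_mono_null (frontier_Iic_prod_Iic_subset (z ^ 2) c) ?_
    rw [Measure.map_apply hLm ((measurableSet_eq_fun measurable_fst measurable_const).union
      (measurableSet_eq_fun measurable_snd measurable_const))]
    refine measure_union_null ?_ ?_
    · exact h1
    · exact h2
  have hconv := tendsto_measureReal_preimage_of_tendstoInDistribution_prod hpair
    (measurableSet_Iic.prod measurableSet_Iic) hfr
  -- identify the two sides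
  have hlimit : P'.real (L ⁻¹' (Iic (z ^ 2) ×ˢ Iic c))
      = (gaussianReal 0 1).real (Icc (-|z|) |z|)
        * (Measure.pi fun _ : Fin (n + 2) => gaussianReal 0 1).real
          {x : Fin (n + 2) → ℝ | ∑ r ∈ univ.erase 0, x r ^ 2 ≤ c} := by
    have hT : MeasurableSet {t : ℝ | t ^ 2 ≤ z ^ 2} :=
      measurableSet_le (by fun_prop) measurable_const
    have h := measure_pooled_inter_homogeneity_limit_eq hs hZm hZ hind hT (measurableSet_Iic (a := c))
    have e : L ⁻¹' (Iic (z ^ 2) ×ˢ Iic c)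
        = {ω' | (∑ j, Z j ω' / s j) / Real.sqrt (∑ j, (s j)⁻¹) ∈ {t : ℝ | t ^ 2 ≤ z ^ 2}}
          ∩ {ω' | ∑ r, (Z r ω' - (∑ j, Z j ω' / s j) / (∑ j, (s j)⁻¹)) ^ 2 / s r ∈ Iic c} := by
      ext ω'
      simp only [hL, Set.mem_preimage, Set.mem_prod, Set.mem_Iic, Set.mem_inter_iff, Set.mem_setOf_eq,
        div_pow, Real.sq_sqrt hW.le]
    rw [measureReal_def, e, h, setOf_sq_le_sq_eq_Icc, ENNReal.toReal_mul, measureReal_def, measureReal_def]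
    simp only [Set.mem_Iic]
  rw [hlimit] at hconv
  refine hconv.congr fun k => ?_
  rfl

/-- **CONDITIONALLY ON PASSING THE HOMOGENEITY TEST, THE POOLED INTERVAL IS STILL CALIBRATED**: same
setting, `c > 0`:
`P((m̂ₖ − a)² ≤ z²·V̂ₖ^pool | Σ_r (Sₖ^r − m̂ₖ)²/V̂ₖ^r ≤ c) → N(0,1)([−|z|,|z|])`
(the ratio of the joint probability to `P(Qₖ ≤ c)`). [ours] -/
theorem kArm_pooled_coverage_conditional {S V : (r : Fin (n + 2)) → ℕ → Ωs r → ℝ} {a : ℝ}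
    {s : Fin (n + 2) → ℝ} {Z : Fin (n + 2) → Ω' → ℝ} (hs : ∀ r, 0 < s r)
    (hSm : ∀ r k, Measurable (S r k)) (hVm : ∀ r k, Measurable (V r k))
    (hclt : ∀ r, TendstoInDistribution (fun (k : ℕ) ω => Real.sqrt k * (S r k ω - a)) atTop (Z r)
      (fun _ => Ps r) P')
    (hZm : ∀ r, Measurable (Z r)) (hZ : ∀ r, HasLaw (Z r) (gaussianReal 0 (s r).toNNReal) P')
    (hind : iIndepFun Z P')
    (hV : ∀ r, ∀ᵐ ω ∂(Ps r), Tendsto (fun k : ℕ => (k : ℝ) * V r k ω) atTop (𝓝 (s r))) (z : ℝ)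
    {c : ℝ} (hc : 0 < c) :
    Tendsto (fun k : ℕ => (Measure.pi Ps).real ({ω : (r : Fin (n + 2)) → Ωs r |
        ((∑ j, S j k (ω j) / V j k (ω j)) / (∑ j, (V j k (ω j))⁻¹) - a) ^ 2 * (∑ j, (V j k (ω j))⁻¹)
          ≤ z ^ 2} ∩ {ω | ∑ r, (S r k (ω r) - (∑ j, S j k (ω j) / V j k (ω j)) / (∑ j, (V j k (ω j))⁻¹)) ^ 2
          / V r k (ω r) ≤ c})
        / (Measure.pi Ps).real {ω : (r : Fin (n + 2)) → Ωs r |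
          ∑ r, (S r k (ω r) - (∑ j, S j k (ω j) / V j k (ω j)) / (∑ j, (V j k (ω j))⁻¹)) ^ 2
            / V r k (ω r) ≤ c})
      atTop (𝓝 ((gaussianReal 0 1).real (Icc (-|z|) |z|))) := by
  have hjoint := kArm_pooled_homogeneity_coverage hs hSm hVm hclt hZm hZ hind hV z c
  have htest := kArm_homogeneity_coverage hs hSm hVm hclt hZm hZ hind hV c
  have hpos := pi_gaussianReal_sumSqErase_le_pos (ι := Fin (n + 2)) 0 hc
  have hdiv := hjoint.div htest hpos.ne'
  rw [mul_div_cancel_right₀ _ hpos.ne'] at hdiv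
  exact hdiv

end AfterTest

end Summit.Ventures.LatticeQCDFlow.Scoring
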